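import Mathlib.Order.Interval.Set.Infinite
import Literature.AlgebraicGeometry.Frobenioids.Dissection
import Literature.AlgebraicGeometry.Frobenioids.ArchimedeanProp35iiiStdCounterexample
import HarnessLib

/-!
# Finite categories are of discontinuously ordered type; the RC-standard base `S → D₀` of the
# [FrdII] Prop. 3.5 (iii) counterexample satisfies ALL standing hypotheses of [FrdII] Cor. 4.2

Mochizuki, *The geometry of Frobenioids II: poly-Frobenioids*, Kyushu J. Math. **62** (2008) 401–460.
§0, kurims text p. 6 ll. 12–17 [cite: MochizukiFrdII2008, §0 p.6]: a monomorphism `φ` is *continuously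
ordered* if the category `C^↣_φ` of its factorizations through monomorphisms is equivalent to `Order(E)`
for a totally ordered set `E` such that "for any `a, b ∈ E` such that `a < b`, there exists a `c ∈ E` such
that `a < c < b`"; "If every … continuously ordered morphism of `C` is an isomorphism, then we shall say
that `C` is of … discontinuously ordered type" (typed by abc-iut-L1-t4: `IsContinuouslyOrderedHom`,
`IsOfDiscontinuouslyOrderedType`, `Dissection.lean`).  Corollary 4.2, standing hypotheses, p. 42
ll. 31–33 [cite: MochizukiFrdII2008, Cor 4.2 p.42]: "let `D_i` be a connected, totally epimorphic
category of discontinuously ordered type, equipped with a functor `D_i → D₀`, with respect to which `D_i`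
is complexifiable"; (v) p. 43 l. 30: "If `D_i` is of RC-standard type, then so is `G_i` [`= N_i`, `R_i`]".

PROOF-ONLY file (abc-iut cell, layer L1, node `FrdII:Prop3.5(iii)`; seat abc-iut-L1-t9 gen 3 = the
typer of `ArchFrd.Prop35iii` / `Prop35iii_N`, closing Finding A of its second read of abc-iut-w4-d027's
P35iii-STD chain `ArchimedeanProp35iiiStd{Base,Props,BaseRC,Counterexample}.lean`).  That chain builds
the four-object base `S → D₀` of RC-standard type over which the typed (= printed) [FrdII] Prop. 3.5 (iii)
fails for the angloid `N` (`P35iiiStd.exists_rcStandard_base_not_prop35iii_N`) and records the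
consequence for the CONCLUSION of Cor. 4.2 (v).  Cor. 4.2 carries one more standing hypothesis on the
base, "of discontinuously ordered type", not verified there.  Here:
* `IsContinuouslyOrderedHom.isIso_of_finite` / `isOfDiscontinuouslyOrderedType_of_finite` (general,
  an elementary consequence of the definitions of §0 p. 6): in a category with finitely many objects and finite
  hom-sets every continuously ordered monomorphism is an isomorphism — for a non-invertible monomorphism
  `φ : A → B` the mono-factorizations `A = A → B` and `A → B = B` are non-isomorphic objects of `C^↣_φ`
  joined by an arrow, so `Order(E) ≃ C^↣_φ` with `E` densely ordered would contain an infinite open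
  interval, whereas `C^↣_φ` has only finitely many objects;
* `P35iiiStd.isOfDiscontinuouslyOrderedType_S`: the toy base `S` is of discontinuously ordered type;
* `P35iiiStd.exists_cor42_hypotheses_base_not_isOfRCStandardType_N`: the packaged kernel record with
  EVERY standing hypothesis of Cor. 4.2 on the base (connected, totally epimorphic, of discontinuously
  ordered type, complexifiable) plus the hypothesis of (v) (RC-standard type), at which `N` is not of
  RC-iso-subanchor type, hence not of RC-standard type — i.e. the conclusion of Cor. 4.2 (v) fails for
  `N` at a base meeting all of Cor. 4.2's printed hypotheses (the tacit Galois-saturation of quotient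
  presentations used in the proof of Prop. 3.5 (i), p. 34 ll. 22–27, is what `S` lacks; the repaired,
  saturated form of Prop. 3.5 (iii) is PROVED in the tree, `ArchFrd.prop35iii_N_of_saturated`).
[FrdII] §4 is not cited by [IUTchI–IV] (record only).  Classical; no definitions; nothing here bears on
[IUTchIII] Cor. 3.12.
-/

namespace Literature.AlgebraicGeometry.Frobenioids

open CategoryTheory

universe v u

/-! ### Finite categories are of discontinuously ordered type -/

section Finite

variable {C : Type u} [Category.{v} C]

/-- In a category with finitely many objects and finite hom-sets, every arrow has finitely many
factorizations `A → X → B` (helper for [FrdII] §0 p. 6). [cite: MochizukiFrdII2008, §0 p.6] -/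
private theorem finite_factorisation [Finite C] [∀ X Y : C, Finite (X ⟶ Y)] {A B : C} (φ : A ⟶ B) :
    Finite (Factorisation φ) :=
  Finite.of_surjective
    (fun p : {p : Σ X : C, (A ⟶ X) × (X ⟶ B) // p.2.1 ≫ p.2.2 = φ} =>
      ({ mid := p.1.1, ι := p.1.2.1, π := p.1.2.2, ι_π := p.2 } : Factorisation φ))
    fun F => ⟨⟨⟨F.mid, F.ι, F.π⟩, F.ι_π⟩, rfl⟩

/-- Hence finitely many factorizations through monomorphisms (objects of `C^↣_φ`).
[cite: MochizukiFrdII2008, §0 p.6] -/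
theorem finite_monoFactorisations [Finite C] [∀ X Y : C, Finite (X ⟶ Y)] {A B : C} (φ : A ⟶ B) :
    Finite (MonoFactorisations φ) := by
  haveI := finite_factorisation φ
  exact Finite.of_injective (fun F : MonoFactorisations φ => F.obj)
    fun F G h => ObjectProperty.FullSubcategory.ext h

/-- **A continuously ordered monomorphism of a category with finitely many objects and finite hom-sets
is an isomorphism.**  If `φ : A → B` is a non-invertible monomorphism, the factorizations
`A —𝟙→ A —φ→ B` and `A —φ→ B —𝟙→ B` are objects of `C^↣_φ` joined by the arrow `φ` but not isomorphic
(an isomorphism between them is an inverse of `φ`); under an equivalence `C^↣_φ ≃ Order(E)` with `E`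
totally and densely ordered they go to `a < b`, and the infinite interval `(a, b) ⊆ E` embeds (objects of
`Order(E)` that become equal in `C^↣_φ` are isomorphic, hence equal) into the finite set of objects of
`C^↣_φ` — a contradiction. [cite: MochizukiFrdII2008, §0 p.6] -/
theorem IsContinuouslyOrderedHom.isIso_of_finite [Finite C] [∀ X Y : C, Finite (X ⟶ Y)]
    {A B : C} {φ : A ⟶ B} (hφ : IsContinuouslyOrderedHom φ) : IsIso φ := by
  obtain ⟨hm, E, _, hE, ⟨e⟩⟩ := hφ
  haveI := hm
  haveI := hE
  by_contra hiso
  -- the two extreme mono-factorizations of `φ` and the arrow `φ` between them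
  let F₁ : MonoFactorisations φ :=
    ⟨{ mid := A, ι := 𝟙 A, π := φ, ι_π := Category.id_comp φ }, ⟨inferInstance, hm⟩⟩
  let F₂ : MonoFactorisations φ :=
    ⟨{ mid := B, ι := φ, π := 𝟙 B, ι_π := Category.comp_id φ }, ⟨hm, inferInstance⟩⟩
  let h₁₂ : F₁ ⟶ F₂ :=
    ObjectProperty.homMk { h := φ, ι_h := Category.id_comp φ, h_π := Category.comp_id φ }
  have hle : e.functor.obj F₁ ≤ e.functor.obj F₂ := (e.functor.map h₁₂).le
  have hne : e.functor.obj F₁ ≠ e.functor.obj F₂ := by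
    intro heq
    have i : F₁ ≅ F₂ := e.fullyFaithfulFunctor.preimageIso (eqToIso heq)
    exact hiso ⟨⟨i.inv.hom.h, i.inv.hom.ι_h, i.inv.hom.h_π⟩⟩
  have hlt : e.functor.obj F₁ < e.functor.obj F₂ := lt_of_le_of_ne hle hne
  -- `E` is finite: it injects into the finitely many objects of `C^↣_φ`
  haveI := finite_monoFactorisations φ
  haveI : Finite E :=
    Finite.of_injective (fun x : E => e.inverse.obj x) fun x y hxy =>
      (e.fullyFaithfulInverse.preimageIso (eqToIso hxy)).to_eq
  -- but the open interval `(F₁, F₂)` of the densely ordered `E` is infinite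
  exact Set.Ioo_infinite hlt (Set.toFinite _)

variable (C) in
/-- **A category with finitely many objects and finite hom-sets is of discontinuously ordered type**
([FrdII] §0 p. 6: every continuously ordered morphism is an isomorphism). [cite: MochizukiFrdII2008, §0 p.6] -/
theorem isOfDiscontinuouslyOrderedType_of_finite [Finite C] [∀ X Y : C, Finite (X ⟶ Y)] :
    IsOfDiscontinuouslyOrderedType C :=
  ⟨fun _ hφ => hφ.isIso_of_finite⟩

end Finite

/-! ### The base `S → D₀` of the Prop. 3.5 (iii) counterexample meets every hypothesis of Cor. 4.2 -/

namespace ArchFrd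

namespace P35iiiStd

/-- The four-object toy base `S` (`ArchimedeanProp35iiiStdBase.lean`) is of discontinuously ordered
type — the standing hypothesis "of discontinuously ordered type" of [FrdII] Cor. 4.2 (p. 42 ll. 31–33)
holds at `S` (finitely many objects, finite hom-sets). [cite: MochizukiFrdII2008, Cor 4.2 p.42] -/
theorem isOfDiscontinuouslyOrderedType_S :
    IsOfDiscontinuouslyOrderedType Literature.AlgebraicGeometry.Frobenioids.ArchFrd.P35iiiStd.S := by
  haveI := finite_S
  haveI : ∀ X Y : S, Finite (X ⟶ Y) := finite_hom
  exact isOfDiscontinuouslyOrderedType_of_finite S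

/-- **The conclusion of [FrdII] Cor. 4.2 (v) fails for `N` at a base satisfying ALL of Cor. 4.2's
printed hypotheses** (kernel record, packaged): there is a base `D → D₀` that is connected, totally
epimorphic, of discontinuously ordered type and complexifiable (the standing hypotheses of Cor. 4.2,
p. 42 ll. 31–33) and of RC-standard type (the hypothesis of (v), p. 43 l. 30) — namely abc-iut-w4-d027's
`S → D₀` — over which the angloid `N = N₀ ×_{D₀} D` of Example 3.3 (iii) is NOT of RC-iso-subanchor
type, hence NOT of RC-standard type ([FrdII] Def. 3.1 (v) (d)).  The printed proof ("assertion (v)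
follows formally from Proposition 3.4, (viii); 3.5, (iii)", p. 45) inherits the tacit Galois-saturation
step of the proof of Prop. 3.5 (i) (p. 34 ll. 22–27); the saturated form of Prop. 3.5 (iii) is proved in
the tree (`ArchFrd.prop35iii_N_of_saturated`).  Record only: [FrdII] §4 is not cited by [IUTchI–IV].
[cite: MochizukiFrdII2008, Cor 4.2 p.42] -/
theorem exists_cor42_hypotheses_base_not_isOfRCStandardType_N :
    ∃ (D : Type) (_ : Category.{0} D) (π : D ⥤ D0),
      IsGraphConnected D ∧ IsTotallyEpimorphic D ∧ IsOfDiscontinuouslyOrderedType D ∧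
        RC.IsComplexifiable (baseRC π) ∧ RC.IsOfRCStandardType (baseRC π) ∧
        ¬ RC.IsOfRCIsoSubanchorType (N.toC π ⋙ PreFrobenioid.baseFunctor (C.toElem π) ⋙ baseRC π) ∧
        ¬ RC.IsOfRCStandardType (N.toC π ⋙ PreFrobenioid.baseFunctor (C.toElem π) ⋙ baseRC π) :=
  ⟨S, inferInstance, Literature.AlgebraicGeometry.Frobenioids.ArchFrd.P35iiiStd.toD0, S.isGraphConnected,
    isOfRCStandardType.totallyEpimorphic, isOfDiscontinuouslyOrderedType_S, isOfRCStandardType.complexifiable,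
    isOfRCStandardType, not_isOfRCIsoSubanchorType_N_std,
    fun h => not_isOfRCIsoSubanchorType_N_std h.rcIsoSubanchor⟩

end P35iiiStd

end ArchFrd

end Literature.AlgebraicGeometry.Frobenioids
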